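import Mathlib
import Summits.CriticalPhenomena.PercolationContinuityZ3.Theorems.PercNearOneGluingNoHeavyLowerTailStarSetTriangleCertificateCore
import HarnessLib

/-!
# `NoHeavyLowerTail` (stmt-CriticalPhenomena-4575) — the TRIANGLE certificate, algebraic core (INSTANTIABLE form)

Support file (prover `prim-gen-swap` gen 8; `--supports stmt-CriticalPhenomena-4575`).  No definitions, no named facts, no sorries; Mathlib only.
`StarSet.triangleCertificate_core` (…StarSetTriangleCertificateCore) assumes a port-lightness hypothesis that the percolation instantiation
cannot supply (a type-B lonely class is made heavy by the link of the class opposite one of its ports).  Here the same two-regime certificate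
(seat memo TRIANGLE-PROOF.md §3–§5) is proved from instantiable event inclusions: a lonely-capable class `i` has its ports `d ≠ i` light with
no links (`sp d ∅ = 1`) and with itself linked (`sp d {i} = 1`); if both classes at a port `d` are lonely-capable then `sp d {d} = 1`; two
lonely-capable classes force the third (`hΛ`).  Result: `StarSet.triangleCertificate_core₂`.
-/


namespace Summit.CriticalPhenomena.PercolationContinuityZ3.Theorems

open Finset
open scoped BigOperators

namespace StarSet

/-- **Triangle certificate, algebraic core — instantiable hypotheses.**  See the file header. [this file; TRIANGLE-PROOF.md §3–§5] -/
theorem triangleCertificate_core₂ (θ : Fin 3 → ℝ) (hθ0 : ∀ i, 0 ≤ θ i) (hθ1 : ∀ i, θ i ≤ 1)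
    (g ℓ : Finset (Fin 3) → ℝ) (sp : Fin 3 → Finset (Fin 3) → ℝ) (chi κ : ℝ)
    (hsp0 : ∀ d σ, 0 ≤ sp d σ)
    (hℓ0 : ∀ σ : Finset (Fin 3), (∀ i, σ ≠ {i}) → ℓ σ = 0) (hℓnn : ∀ i, 0 ≤ ℓ {i}) (hℓ1 : ∀ i, ℓ {i} ≤ 1)
    (hlt : ∀ i, ℓ {i} ≠ 0 → ∀ d, d ≠ i → sp d ∅ = 1)
    (hLsp : ∀ i, ℓ {i} ≠ 0 → ∀ d, d ≠ i → sp d {i} = 1)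
    (hAA : ∀ d, (∀ i, i ≠ d → ℓ {i} ≠ 0) → sp d {d} = 1)
    (hΛ : ∀ i i', i ≠ i' → ℓ {i} ≠ 0 → ℓ {i'} ≠ 0 → ∀ k, ℓ {k} ≠ 0)
    (hchi0 : 0 ≤ chi) (hκ0 : 0 ≤ κ) (hκ : 2 < ∑ i, θ i → 1 / 2 ≤ κ)
    (hc : (∀ σ, g σ = 0) ∨ ((∀ σ, g σ = 1) ∧ chi = 1) ∨
      (∃ r, (∀ σ, g σ = if σ ⊆ {r} then 1 else 0) ∧ (∀ σ, sp r σ = g σ) ∧ (∀ i, i ≠ r → ℓ {i} = 0))) :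
    ∑ d, (if ∑ i, θ i ≤ 2 then (1 - θ d) / (3 - ∑ i, θ i) else 1 / 2) *
        ∑ σ ∈ (univ : Finset (Fin 3)).powerset, ((∏ i ∈ σ, θ i) * ∏ i ∈ univ \ σ, (1 - θ i)) * (g σ - sp d σ) ≤
      (∑ σ ∈ (univ : Finset (Fin 3)).powerset, ((∏ i ∈ σ, θ i) * ∏ i ∈ univ \ σ, (1 - θ i)) * (g σ - ℓ σ)) + κ * chi := by
  set W : Finset (Fin 3) → ℝ := fun σ => (∏ i ∈ σ, θ i) * ∏ i ∈ univ \ σ, (1 - θ i) with hW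
  set S : ℝ := ∑ i, θ i with hS
  set x : Fin 3 → ℝ := fun d => if S ≤ 2 then (1 - θ d) / (3 - S) else 1 / 2 with hx
  set P : Finset (Finset (Fin 3)) := (univ : Finset (Fin 3)).powerset with hP
  have hWnn : ∀ σ, 0 ≤ W σ := fun σ => mul_nonneg (prod_nonneg fun i _ => hθ0 i) (prod_nonneg fun i _ => sub_nonneg.2 (hθ1 i))
  have hS3 : S ≤ 3 := by
    have : ∑ i, θ i ≤ ∑ _i : Fin 3, (1 : ℝ) := sum_le_sum fun i _ => hθ1 i
    simpa using this
  have hS0 : 0 ≤ S := sum_nonneg fun i _ => hθ0 i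
  have hxnn : ∀ d, 0 ≤ x d := by
    intro d; simp only [hx]
    split_ifs with h
    · exact div_nonneg (sub_nonneg.2 (hθ1 d)) (by linarith)
    · norm_num
  set Z : ℝ := ∏ i, (1 - θ i) with hZ
  set Zd : Fin 3 → ℝ := fun d => ∏ j ∈ univ.erase d, (1 - θ j) with hZd
  have hZdnn : ∀ d, 0 ≤ Zd d := fun d => prod_nonneg fun j _ => sub_nonneg.2 (hθ1 j)
  have hWempty : W ∅ = Z := by simp [hW, hZ]
  have hWsing : ∀ i, W {i} = θ i * Zd i := by
    intro i
    simp only [hW, hZd, prod_singleton]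
    congr 1
    congr 1
    ext j; simp [mem_erase, eq_comm]
  have hZsplit : ∀ d, Z = (1 - θ d) * Zd d := by
    intro d
    rw [hZ, hZd, ← mul_prod_erase univ (fun j => 1 - θ j) (mem_univ d)]
  have hZd_eq : ∀ d, W ∅ + W {d} = Zd d := by
    intro d; rw [hWempty, hWsing, hZsplit d]; ring
  have hsumW : ∑ σ ∈ P, W σ = 1 := by
    have h := cylinder_sum_closed θ (∅ : Finset (Fin 3))
    simp only [notMem_empty, IsEmpty.forall_iff, implies_true, if_true, mul_one, prod_empty] at h
    exact h
  have hsum_sub : ∀ r, ∑ σ ∈ P, W σ * (if σ ⊆ {r} then (1 : ℝ) else 0) = Zd r := by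
    intro r
    have h := cylinder_sum_closed θ (univ.erase r)
    simp only [hZd]
    rw [← h]
    refine sum_congr rfl fun σ _ => ?_
    congr 1
    by_cases hσ : σ ⊆ {r}
    · rw [if_pos hσ, if_pos]
      intro k hk hkσ
      exact (mem_erase.1 hk).1 (mem_singleton.1 (hσ hkσ))
    · rw [if_neg hσ, if_neg]
      intro hk
      apply hσ
      intro j hj
      rw [mem_singleton]
      by_contra hne
      exact hk j (mem_erase.2 ⟨hne, mem_univ _⟩) hj
  set T : Finset (Finset (Fin 3)) := {∅, {0}, {1}, {2}} with hT
  have hTP : T ⊆ P := fun σ _ => mem_powerset.2 (subset_univ _)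
  have hℓsum : ∑ σ ∈ P, W σ * ℓ σ = ∑ i, W {i} * ℓ {i} := by
    have h1 : ∑ σ ∈ P, W σ * ℓ σ = ∑ σ ∈ T, W σ * ℓ σ := by
      symm
      refine sum_subset hTP fun σ _ hσT => ?_
      rw [hℓ0 σ (fun i h => hσT ((mem_smallPatterns_iff σ).2 (Or.inr ⟨i, h⟩))), mul_zero]
    rw [h1, hT]
    rw [sum_insert (by decide), sum_insert (by decide), sum_insert (by decide), sum_singleton]
    rw [hℓ0 ∅ (fun i h => by have := h ▸ mem_singleton_self i; simp at this), mul_zero, zero_add]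
    rw [Fin.sum_univ_three]
    ring
  have hRlow : ∀ d, W ∅ * sp d ∅ + W {0} * sp d {0} + W {1} * sp d {1} + W {2} * sp d {2} ≤ ∑ σ ∈ P, W σ * sp d σ := by
    intro d
    have h := sum_le_sum_of_subset_of_nonneg hTP (f := fun σ => W σ * sp d σ)
      (fun σ _ _ => mul_nonneg (hWnn σ) (hsp0 d σ))
    rw [hT, sum_insert (by decide), sum_insert (by decide), sum_insert (by decide), sum_singleton] at h
    linarith
  have hpay : ∀ d i, i ≠ d → W {i} * ℓ {i} ≤ W {i} * sp d {i} := by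
    intro d i hid
    by_cases h : ℓ {i} = 0
    · rw [h, mul_zero]; exact mul_nonneg (hWnn _) (hsp0 _ _)
    · rw [hLsp i h d (Ne.symm hid)]; exact mul_le_mul_of_nonneg_left (hℓ1 i) (hWnn _)
  have hbase : (∀ k, ℓ {k} ≠ 0) → ∀ d i, i ≠ d → Zd d * ℓ {i} ≤ W ∅ * sp d ∅ + W {d} * sp d {d} := by
    intro hall d i hid
    rw [hlt i (hall i) d (Ne.symm hid), hAA d (fun k hk => hall k), mul_one, mul_one, hZd_eq]
    exact mul_le_of_le_one_right (hZdnn d) (hℓ1 i)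
  set R : Fin 3 → ℝ := fun d => ∑ σ ∈ P, W σ * sp d σ with hR
  set G : ℝ := ∑ σ ∈ P, W σ * g σ with hG
  set L : ℝ := ∑ i, W {i} * ℓ {i} with hL
  have hLHS : ∀ d, ∑ σ ∈ P, W σ * (g σ - sp d σ) = G - R d := by
    intro d
    have : ∑ σ ∈ P, W σ * (g σ - sp d σ) = (∑ σ ∈ P, W σ * g σ) - ∑ σ ∈ P, W σ * sp d σ := by
      rw [← sum_sub_distrib]; exact sum_congr rfl fun σ _ => by ring
    rw [this]
  have hRHS : ∑ σ ∈ P, W σ * (g σ - ℓ σ) = G - L := by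
    have : ∑ σ ∈ P, W σ * (g σ - ℓ σ) = (∑ σ ∈ P, W σ * g σ) - ∑ σ ∈ P, W σ * ℓ σ := by
      rw [← sum_sub_distrib]; exact sum_congr rfl fun σ _ => by ring
    rw [this, hℓsum]
  have hgoal : ∑ d, x d * ∑ σ ∈ P, W σ * (g σ - sp d σ) = ∑ d, x d * (G - R d) :=
    sum_congr rfl fun d _ => by rw [hLHS d]
  change ∑ d, x d * ∑ σ ∈ P, W σ * (g σ - sp d σ) ≤ (∑ σ ∈ P, W σ * (g σ - ℓ σ)) + κ * chi
  rw [hgoal, hRHS]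
  have hX : ∑ d, x d ≤ 1 + κ ∧ (∑ i, θ i ≤ 2 → ∑ d, x d = 1) := by
    constructor
    · rw [Fin.sum_univ_three]
      by_cases hreg : S ≤ 2
      · have hE : 0 < 3 - S := by linarith
        have : x 0 + x 1 + x 2 = 1 := by
          simp only [hx, if_pos hreg]
          rw [← add_div, ← add_div, div_eq_one_iff_eq (ne_of_gt hE), hS, Fin.sum_univ_three]; ring
        linarith
      · push Not at hreg
        have hk := hκ (show 2 < S from hreg)
        simp only [hx, if_neg (not_le.2 hreg)]
        linarith
    · intro hreg
      rw [Fin.sum_univ_three]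
      have hreg' : S ≤ 2 := hreg
      have hE : 0 < 3 - S := by linarith
      simp only [hx, if_pos hreg']
      rw [← add_div, ← add_div, div_eq_one_iff_eq (ne_of_gt hE), hS, Fin.sum_univ_three]; ring
  have hpair : ∀ r, ∑ d ∈ univ.erase r, x d ≤ 1 := by
    intro r
    by_cases hreg : S ≤ 2
    · have h1 := hX.2 hreg
      rw [← Finset.add_sum_erase univ x (mem_univ r)] at h1
      linarith [hxnn r]
    · have : ∀ d, x d = 1 / 2 := fun d => by simp only [hx, if_neg hreg]
      simp only [this, sum_const, card_erase_of_mem (mem_univ r), card_univ, Fintype.card_fin, nsmul_eq_mul]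
      norm_num
  have hpair_ge : ∀ r, θ r ≤ ∑ d ∈ univ.erase r, x d := by
    intro r
    by_cases hreg : S ≤ 2
    · have h1 := hX.2 hreg
      rw [← Finset.add_sum_erase univ x (mem_univ r)] at h1
      have hxr : x r = (1 - θ r) / (3 - S) := by simp only [hx, if_pos hreg]
      have hE1 : 1 ≤ 3 - S := by linarith
      have hle : (1 - θ r) / (3 - S) ≤ 1 - θ r := div_le_self (sub_nonneg.2 (hθ1 r)) hE1
      linarith
    · have : ∀ d, x d = 1 / 2 := fun d => by simp only [hx, if_neg hreg]
      simp only [this, sum_const, card_erase_of_mem (mem_univ r), card_univ, Fintype.card_fin, nsmul_eq_mul]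
      have := hθ1 r
      norm_num
      linarith
  -- KEY port-side inequality: L ≤ Σ_d x_d R_d, in both regimes
  have hkey : L ≤ ∑ d, x d * R d := by
    by_cases hall : ∀ k, ℓ {k} ≠ 0
    · -- all three classes lonely-capable (all ports singletons)
        -- R_d ≥ Zd d · (ℓ_i + ℓ_i')/2-type base + the two singleton payments; we use explicit indices
        have hR0 : Zd 0 * ℓ {1} ≤ R 0 ∧ Zd 0 * ℓ {2} ≤ R 0 ∧ W {1} * ℓ {1} + W {2} * ℓ {2} + Zd 0 * ℓ {1} ≤ R 0 ∧
            W {1} * ℓ {1} + W {2} * ℓ {2} + Zd 0 * ℓ {2} ≤ R 0 := by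
          have h := hRlow 0
          have p1 := hpay 0 1 (by decide); have p2 := hpay 0 2 (by decide)
          have b1 := hbase hall 0 1 (by decide); have b2 := hbase hall 0 2 (by decide)
          have n0 : 0 ≤ W {0} * sp 0 {0} := mul_nonneg (hWnn _) (hsp0 _ _)
          have nE : 0 ≤ W ∅ * sp 0 ∅ := mul_nonneg (hWnn _) (hsp0 _ _)
          have n1 : 0 ≤ W {1} * ℓ {1} := mul_nonneg (hWnn _) (hℓnn _)
          have n2 : 0 ≤ W {2} * ℓ {2} := mul_nonneg (hWnn _) (hℓnn _)
          refine ⟨by linarith, by linarith, by linarith, by linarith⟩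
        have hR1 : Zd 1 * ℓ {0} ≤ R 1 ∧ Zd 1 * ℓ {2} ≤ R 1 ∧ W {0} * ℓ {0} + W {2} * ℓ {2} + Zd 1 * ℓ {0} ≤ R 1 ∧
            W {0} * ℓ {0} + W {2} * ℓ {2} + Zd 1 * ℓ {2} ≤ R 1 := by
          have h := hRlow 1
          have p1 := hpay 1 0 (by decide); have p2 := hpay 1 2 (by decide)
          have b1 := hbase hall 1 0 (by decide); have b2 := hbase hall 1 2 (by decide)
          have n0 : 0 ≤ W {1} * sp 1 {1} := mul_nonneg (hWnn _) (hsp0 _ _)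
          have nE : 0 ≤ W ∅ * sp 1 ∅ := mul_nonneg (hWnn _) (hsp0 _ _)
          have n1 : 0 ≤ W {0} * ℓ {0} := mul_nonneg (hWnn _) (hℓnn _)
          have n2 : 0 ≤ W {2} * ℓ {2} := mul_nonneg (hWnn _) (hℓnn _)
          refine ⟨by linarith, by linarith, by linarith, by linarith⟩
        have hR2 : Zd 2 * ℓ {0} ≤ R 2 ∧ Zd 2 * ℓ {1} ≤ R 2 ∧ W {0} * ℓ {0} + W {1} * ℓ {1} + Zd 2 * ℓ {0} ≤ R 2 ∧
            W {0} * ℓ {0} + W {1} * ℓ {1} + Zd 2 * ℓ {1} ≤ R 2 := by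
          have h := hRlow 2
          have p1 := hpay 2 0 (by decide); have p2 := hpay 2 1 (by decide)
          have b1 := hbase hall 2 0 (by decide); have b2 := hbase hall 2 1 (by decide)
          have n0 : 0 ≤ W {2} * sp 2 {2} := mul_nonneg (hWnn _) (hsp0 _ _)
          have nE : 0 ≤ W ∅ * sp 2 ∅ := mul_nonneg (hWnn _) (hsp0 _ _)
          have n1 : 0 ≤ W {0} * ℓ {0} := mul_nonneg (hWnn _) (hℓnn _)
          have n2 : 0 ≤ W {1} * ℓ {1} := mul_nonneg (hWnn _) (hℓnn _)
          refine ⟨by linarith, by linarith, by linarith, by linarith⟩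
        -- numeric data
        have hW0 := hWsing 0; have hW1 := hWsing 1; have hW2 := hWsing 2
        have hZ0 := hZsplit 0; have hZ1 := hZsplit 1; have hZ2 := hZsplit 2
        have hl0 := hℓnn 0; have hl1 := hℓnn 1; have hl2 := hℓnn 2
        have hl0' := hℓ1 0; have hl1' := hℓ1 1; have hl2' := hℓ1 2
        have ht0 := hθ0 0; have ht1 := hθ0 1; have ht2 := hθ0 2
        have ht0' := hθ1 0; have ht1' := hθ1 1; have ht2' := hθ1 2
        have hZd0 := hZdnn 0; have hZd1 := hZdnn 1; have hZd2 := hZdnn 2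
        have hS' : S = θ 0 + θ 1 + θ 2 := by rw [hS, Fin.sum_univ_three]
        rw [Fin.sum_univ_three]
        rw [hL, Fin.sum_univ_three]
        by_cases hreg : S ≤ 2
        · -- regime S ≤ 2: x_d = (1 − θ_d)/(3 − S)
          have hE : 0 < 3 - S := by linarith
          have hx0 : x 0 = (1 - θ 0) / (3 - S) := by simp only [hx, if_pos hreg]
          have hx1 : x 1 = (1 - θ 1) / (3 - S) := by simp only [hx, if_pos hreg]
          have hx2 : x 2 = (1 - θ 2) / (3 - S) := by simp only [hx, if_pos hreg]
          -- use R_d ≥ (singleton payments) + Zd d·(ℓ_i + ℓ_i')/2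
          have hRb0 : W {1} * ℓ {1} + W {2} * ℓ {2} + Zd 0 * (ℓ {1} + ℓ {2}) / 2 ≤ R 0 := by
            rcases hR0 with ⟨-, -, a, b⟩; linarith
          have hRb1 : W {0} * ℓ {0} + W {2} * ℓ {2} + Zd 1 * (ℓ {0} + ℓ {2}) / 2 ≤ R 1 := by
            rcases hR1 with ⟨-, -, a, b⟩; linarith
          have hRb2 : W {0} * ℓ {0} + W {1} * ℓ {1} + Zd 2 * (ℓ {0} + ℓ {1}) / 2 ≤ R 2 := by
            rcases hR2 with ⟨-, -, a, b⟩; linarith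
          have hx0nn := hxnn 0; have hx1nn := hxnn 1; have hx2nn := hxnn 2
          have step : x 0 * (W {1} * ℓ {1} + W {2} * ℓ {2} + Zd 0 * (ℓ {1} + ℓ {2}) / 2) +
              x 1 * (W {0} * ℓ {0} + W {2} * ℓ {2} + Zd 1 * (ℓ {0} + ℓ {2}) / 2) +
              x 2 * (W {0} * ℓ {0} + W {1} * ℓ {1} + Zd 2 * (ℓ {0} + ℓ {1}) / 2) ≤
              x 0 * R 0 + x 1 * R 1 + x 2 * R 2 := by
            have := mul_le_mul_of_nonneg_left hRb0 hx0nn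
            have := mul_le_mul_of_nonneg_left hRb1 hx1nn
            have := mul_le_mul_of_nonneg_left hRb2 hx2nn
            linarith
          refine le_trans ?_ step
          -- algebra: with x_d (1−θ_d)... everything in terms of Z, θ, ℓ
          -- x_d * Zd d = Z/(3−S);  x_j + x_k = 1 − (1−θ_i)/(3−S);  W{i}(1−θ_i) = θ_i Z
          have hxZ0 : (1 - θ 0) * Zd 0 = Z := (hZsplit 0).symm
          have hxZ1 : (1 - θ 1) * Zd 1 = Z := (hZsplit 1).symm
          have hxZ2 : (1 - θ 2) * Zd 2 = Z := (hZsplit 2).symm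
          rw [hx0, hx1, hx2]
          rw [hW0, hW1, hW2]
          -- clear denominators: RHS = (Σ_d (1−θ_d)·A_d)/(3−S)
          rw [div_mul_eq_mul_div, div_mul_eq_mul_div, div_mul_eq_mul_div, ← add_div, ← add_div, le_div_iff₀ hE]
          rw [hS'] 
          have hZnn : 0 ≤ Z := by rw [hZ0]; exact mul_nonneg (sub_nonneg.2 ht0') hZd0
          -- the products (1−θ_d)·Zd_d collapse to Z
          have f0 : (1 - θ 0) * (Zd 0 * (ℓ {1} + ℓ {2}) / 2) = Z * (ℓ {1} + ℓ {2}) / 2 := by rw [← hxZ0]; ring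
          have f1 : (1 - θ 1) * (Zd 1 * (ℓ {0} + ℓ {2}) / 2) = Z * (ℓ {0} + ℓ {2}) / 2 := by rw [← hxZ1]; ring
          have f2 : (1 - θ 2) * (Zd 2 * (ℓ {0} + ℓ {1}) / 2) = Z * (ℓ {0} + ℓ {1}) / 2 := by rw [← hxZ2]; ring
          have g0 : θ 0 * Zd 0 * ℓ {0} * (1 - θ 0) = Z * (θ 0 * ℓ {0}) := by rw [← hxZ0]; ring
          have g1 : θ 1 * Zd 1 * ℓ {1} * (1 - θ 1) = Z * (θ 1 * ℓ {1}) := by rw [← hxZ1]; ring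
          have g2 : θ 2 * Zd 2 * ℓ {2} * (1 - θ 2) = Z * (θ 2 * ℓ {2}) := by rw [← hxZ2]; ring
          have k0 : Z * (θ 0 * ℓ {0}) ≤ Z * ℓ {0} := mul_le_mul_of_nonneg_left (mul_le_of_le_one_left hl0 ht0') hZnn
          have k1 : Z * (θ 1 * ℓ {1}) ≤ Z * ℓ {1} := mul_le_mul_of_nonneg_left (mul_le_of_le_one_left hl1 ht1') hZnn
          have k2 : Z * (θ 2 * ℓ {2}) ≤ Z * ℓ {2} := mul_le_mul_of_nonneg_left (mul_le_of_le_one_left hl2 ht2') hZnn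
          linarith [f0, f1, f2, g0, g1, g2, k0, k1, k2]
        · -- regime S > 2: x ≡ 1/2
          have hx0 : x 0 = 1 / 2 := by simp only [hx, if_neg hreg]
          have hx1 : x 1 = 1 / 2 := by simp only [hx, if_neg hreg]
          have hx2 : x 2 = 1 / 2 := by simp only [hx, if_neg hreg]
          rw [hx0, hx1, hx2]
          rcases hR0 with ⟨-, -, a0, -⟩
          rcases hR1 with ⟨-, -, a1, -⟩
          rcases hR2 with ⟨-, -, a2, -⟩
          have n1 : 0 ≤ Zd 0 * ℓ {1} := mul_nonneg hZd0 hl1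
          have n2 : 0 ≤ Zd 1 * ℓ {0} := mul_nonneg hZd1 hl0
          have n3 : 0 ≤ Zd 2 * ℓ {0} := mul_nonneg hZd2 hl0
          linarith
    · -- at most ONE lonely-capable class
      push Not at hall
      obtain ⟨k₀, hk₀⟩ := hall
      have hone : ∀ i i', i ≠ i' → ℓ {i} ≠ 0 → ℓ {i'} = 0 := by
        intro i i' hii' hi
        by_contra hi'
        exact (hΛ i i' hii' hi hi' k₀) hk₀
      have hRnn : ∀ d, 0 ≤ R d := fun d => sum_nonneg fun σ _ => mul_nonneg (hWnn σ) (hsp0 d σ)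
      -- one-class bound
      have hsingle : ∀ i₀, (∀ j, j ≠ i₀ → ℓ {j} = 0) → L ≤ ∑ d, x d * R d := by
        intro i₀ hz
        by_cases hi : ℓ {i₀} = 0
        · have hL0 : L = 0 := by
            rw [hL]
            exact sum_eq_zero fun i _ => by
              by_cases h : i = i₀
              · rw [h, hi, mul_zero]
              · rw [hz i h, mul_zero]
          rw [hL0]
          exact sum_nonneg fun d _ => mul_nonneg (hxnn d) (hRnn d)
        · have hLi : L = W {i₀} * ℓ {i₀} := by
            rw [hL, ← Finset.add_sum_erase univ (fun i => W {i} * ℓ {i}) (mem_univ i₀),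
              sum_eq_zero (fun j hj => by rw [hz j (mem_erase.1 hj).1, mul_zero]), add_zero]
          have hRd : ∀ d, d ≠ i₀ → Zd i₀ ≤ R d := by
            intro d hd
            have hsub : ({∅, {i₀}} : Finset (Finset (Fin 3))) ⊆ P := fun σ _ => mem_powerset.2 (subset_univ _)
            have hle := sum_le_sum_of_subset_of_nonneg hsub (f := fun σ => W σ * sp d σ)
              (fun σ _ _ => mul_nonneg (hWnn σ) (hsp0 d σ))
            rw [sum_insert (by simp), sum_singleton, hlt i₀ hi d hd, hLsp i₀ hi d hd, mul_one, mul_one, hZd_eq] at hle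
            exact hle
          have hs := hpair_ge i₀
          have hsnn : 0 ≤ ∑ d ∈ univ.erase i₀, x d := sum_nonneg fun d _ => hxnn d
          calc L = W {i₀} * ℓ {i₀} := hLi
            _ ≤ W {i₀} := mul_le_of_le_one_right (hWnn _) (hℓ1 i₀)
            _ = θ i₀ * Zd i₀ := hWsing i₀
            _ ≤ (∑ d ∈ univ.erase i₀, x d) * Zd i₀ := mul_le_mul_of_nonneg_right hs (hZdnn i₀)
            _ = ∑ d ∈ univ.erase i₀, x d * Zd i₀ := by rw [sum_mul]
            _ ≤ ∑ d ∈ univ.erase i₀, x d * R d := sum_le_sum fun d hd => mul_le_mul_of_nonneg_left (hRd d (mem_erase.1 hd).1) (hxnn d)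
            _ ≤ ∑ d, x d * R d := by
                rw [← Finset.add_sum_erase univ (fun d => x d * R d) (mem_univ i₀)]
                linarith [mul_nonneg (hxnn i₀) (hRnn i₀)]
      -- which class (if any) is lonely-capable
      by_cases h0 : ℓ {0} = 0
      · by_cases h1 : ℓ {1} = 0
        · refine hsingle 2 (fun j hj => ?_)
          fin_cases j
          · exact h0
          · exact h1
          · exact absurd rfl hj
        · refine hsingle 1 (fun j hj => ?_)
          fin_cases j
          · exact h0
          · exact absurd rfl hj
          · exact hone 1 2 (by decide) h1
      · refine hsingle 0 (fun j hj => ?_)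
        fin_cases j
        · exact absurd rfl hj
        · exact hone 0 1 (by decide) h0
        · exact hone 0 2 (by decide) h0
  -- the three cases for c
  rcases hc with hheavy | ⟨hiso, hchi⟩ | ⟨r, hgr, hspr, hℓr⟩
  · -- (i) c heavy: G = 0
    have hG0 : G = 0 := by rw [hG]; simp [hheavy]
    rw [hG0]
    have : ∑ d, x d * (0 - R d) = -(∑ d, x d * R d) := by rw [← sum_neg_distrib]; exact sum_congr rfl fun d _ => by ring
    rw [this]
    nlinarith [hkey, mul_nonneg hκ0 hchi0]
  · -- (ii) c light and isolated: G = 1, chi = 1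
    have hG1 : G = 1 := by rw [hG]; simp only [hiso, mul_one]; exact hsumW
    rw [hG1, hchi, mul_one]
    have : ∑ d, x d * (1 - R d) = (∑ d, x d) - ∑ d, x d * R d := by
      rw [← sum_sub_distrib]; exact sum_congr rfl fun d _ => by ring
    rw [this]
    linarith [hkey, hX.1]
  · -- (iii) c glued to port r: G = Zd r = R r; only class r can be lonely
    have hGr : G = Zd r := by rw [hG, ← hsum_sub r]; exact sum_congr rfl fun σ _ => by rw [hgr σ]
    have hRr : R r = G := by rw [hR, hG]; exact sum_congr rfl fun σ _ => by rw [hspr σ]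
    -- L = W{r} ℓ{r}
    have hLr : L = W {r} * ℓ {r} := by
      rw [hL, ← Finset.add_sum_erase univ (fun i => W {i} * ℓ {i}) (mem_univ r)]
      rw [sum_eq_zero (fun i hi => by rw [hℓr i (mem_erase.1 hi).1, mul_zero]), add_zero]
    -- R_d ≥ Zd r · ℓ{r} for d ≠ r
    have hRd : ∀ d, d ≠ r → Zd r * ℓ {r} ≤ R d := by
      intro d hdr
      by_cases h : ℓ {r} = 0
      · rw [h, mul_zero]; exact sum_nonneg fun σ _ => mul_nonneg (hWnn σ) (hsp0 d σ)
      · have h1 : sp d ∅ = 1 := hlt r h d hdr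
        have h2 : sp d {r} = 1 := hLsp r h d hdr
        have hsub : ({∅, {r}} : Finset (Finset (Fin 3))) ⊆ P := fun σ _ => mem_powerset.2 (subset_univ _)
        have hle := sum_le_sum_of_subset_of_nonneg hsub (f := fun σ => W σ * sp d σ) (fun σ _ _ => mul_nonneg (hWnn σ) (hsp0 d σ))
        rw [sum_insert (by simp), sum_singleton, h1, h2, mul_one, mul_one, hZd_eq] at hle
        exact le_trans (mul_le_of_le_one_right (hZdnn r) (hℓ1 r)) hle
    -- split the d-sum at r
    rw [← Finset.add_sum_erase univ (fun d => x d * (G - R d)) (mem_univ r)]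
    simp only [hRr, sub_self, mul_zero, zero_add]
    have hrest : ∑ d ∈ univ.erase r, x d * (G - R d) ≤ (∑ d ∈ univ.erase r, x d) * (Zd r * (1 - ℓ {r})) := by
      rw [sum_mul]
      refine sum_le_sum fun d hd => ?_
      have hdr : d ≠ r := (mem_erase.1 hd).1
      have := hRd d hdr
      have : G - R d ≤ Zd r * (1 - ℓ {r}) := by rw [hGr]; linarith
      exact mul_le_mul_of_nonneg_left this (hxnn d)
    refine le_trans hrest ?_
    rw [hLr, hGr, hWsing r]
    have hs := hpair r
    have hsnn : 0 ≤ ∑ d ∈ univ.erase r, x d := sum_nonneg fun d _ => hxnn d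
    nlinarith [hZdnn r, hℓnn r, hℓ1 r, hθ0 r, hθ1 r, mul_nonneg hκ0 hchi0,
      mul_nonneg (hZdnn r) (sub_nonneg.2 (hℓ1 r)), mul_nonneg (mul_nonneg (hZdnn r) (hℓnn r)) (sub_nonneg.2 (hθ1 r))]

end StarSet

end Summit.CriticalPhenomena.PercolationContinuityZ3.Theorems
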